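import Summits.BirchSwinnertonDyer.BirchSwinnertonDyer.Theorems.ByReductionTypeAtTwoFineSelmerConjAAtTwoAdditivePotGoodCapitulationDoorLayerOne
import Summits.BirchSwinnertonDyer.BirchSwinnertonDyer.Theorems.ByReductionTypeAtTwoFineSelmerConjAAtTwoAdditivePotGoodCapitulationIdealAlgebra
import Summits.BirchSwinnertonDyer.BirchSwinnertonDyer.Theorems.ByReductionTypeAtTwoFineSelmerConjAAtTwoAdditivePotGoodClassGroupCyclicCriterion
import HarnessLib

/-!
# Route `ByReductionTypeAtTwo` (rung K4), crux C1″ `FineSelmerConjAAtTwoAdditivePotGood` (item stmt-BirchSwinnertonDyer-22615):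
# THE CAPITULATION CERTIFICATE — an ambiguous class of `K(√2)` with prescribed norm class from ONE ideal identity
# `(y) · (n, β, s + t) = (g) · (n, β, s − t)` in `𝓞 K(√2)` (six ring identities), and the resulting discharge of the displayed hypothesis
# `e₁ = e₀` of the «Fukuda row» stamps `conjA_two_<L>_of_fukudaLayers`
# (a `--supports 22615` toolkit file; seat `bsd-2adic-k4-w1` GEN 7; consumer of `…CapitulationIdealAlgebra`, `…CapitulationDoorLayerOne`
# (p707404) and `…ClassGroupCyclicCriterion`; consumed by the per-row certificate files and `…CapitulationDoorTwoPrimes`)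

HONEST FRAMING (cell `bsd-2adic`, D-0036/D-0054): UNCONDITIONAL kernel lemmas; closes nothing; nothing booked; BSD is not proved by any of
this.

CONTENTS. `mulEquiv_intAut_mk0_eq_self_of_identity` — `[τ I] = [I]` for all `τ ∈ Gal(L/K)`, `I = (n, β, s − t)`, from six generator
memberships (explicit coefficients, pure ring identities in `𝓞 L`); `mk0_eq_mk0_of_eq_mul_span_singleton` (a principal factor does not
change the class); `exists_eq_mul_and_sq_eq`, `exists_two_mul_eq_of_quadratic` (second generators of `𝓞 K(√2)` over `𝓞 K[√2]`, needed
when `2` ramifies in `K`); `exists_ambiguous_of_certificate` — THE CERTIFICATE: `⟨[(n, β)]⟩ = Cl(K)` (cyclic criterion), Bezout data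
`t² − 2 = n w`, `u n + v w = 1`, `a·2t + c n = 1`, and for every quadratic `L/K` with `s² = 2` in `𝓞 L` the six memberships ⟹ a
`Gal(K₁/K)`-fixed class `c` of the first layer `K₁` of the cyclotomic `ℤ₂`-tower with `h_K ∣ ord N c`;
`classNumberPExp_one_eq_classNumberPExp_zero_of_certificate` — with one prime above `2`, `e₁ = e₀` (door `…CapitulationDoorLayerOne`).
The L-side hypothesis is quantified over an ABSTRACT extension `L` and stated with ring identities only, so that the per-row files never
unify terms across `𝓞 (κ.layer 1)` (kernel-expensive).

References: [Lang1990] Ch. 13 §4, Lemma 4.1; [Gras2003] II.6.2 (ambiguous classes, genus theory); [Marcus1977] Ch. 2 Thm. 2, Cor. 2.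
-/

set_option autoImplicit false
-- sibling precedent (`…CapitulationDoorLayerOne.lean`): the directory name repeats the summit name
set_option linter.dupNamespace false

noncomputable section

open scoped Classical NumberField nonZeroDivisors

namespace Summit.BirchSwinnertonDyer.BirchSwinnertonDyer.Theorems.AddKatoTwo

open NumberField IsDedekindDomain UniqueFactorizationMonoid Polynomial
open Literature.NumberTheory.NumberFields Literature.NumberTheory.NumberFields.AmbiguousClass
  Literature.NumberTheory.GaloisRepresentations Literature.NumberTheory.IwasawaTheory Literature.NumberTheory.EllipticCurves

/-! ## §1 The fixed class from the identity -/

section Galois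

variable {K L : Type} [Field K] [NumberField K] [Field L] [NumberField L] [Algebra K L]

omit [NumberField K] in
/-- **`[τ I] = [I]` for every `τ ∈ Gal(L/K)`**, `I = (n, β, s − t)`, from ONE identity `(y)(n, β, s + t) = (g)(n, β, s − t)` with `g ≠ 0`,
the identity being given by its six generator memberships (explicit coefficients `u, v, w ∈ 𝓞 L`; then `y ≠ 0` automatically).
[cite: Gras2003, II.6.2 (ambiguous classes)] -/
theorem mulEquiv_intAut_mk0_eq_self_of_identity {s : 𝓞 L} (hs : s ^ 2 = 2) (n : ℕ) (β : 𝓞 K) (t : ℤ) {y g : 𝓞 L} (hg : g ≠ 0)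
    (h1 : ∃ u v w : 𝓞 L, y * (n : 𝓞 L) = g * (u * (n : 𝓞 L) + v * algebraMap (𝓞 K) (𝓞 L) β + w * (s - (t : 𝓞 L))))
    (h2 : ∃ u v w : 𝓞 L, y * algebraMap (𝓞 K) (𝓞 L) β = g * (u * (n : 𝓞 L) + v * algebraMap (𝓞 K) (𝓞 L) β + w * (s - (t : 𝓞 L))))
    (h3 : ∃ u v w : 𝓞 L, y * (s + (t : 𝓞 L)) = g * (u * (n : 𝓞 L) + v * algebraMap (𝓞 K) (𝓞 L) β + w * (s - (t : 𝓞 L))))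
    (h4 : ∃ u v w : 𝓞 L, g * (n : 𝓞 L) = y * (u * (n : 𝓞 L) + v * algebraMap (𝓞 K) (𝓞 L) β + w * (s + (t : 𝓞 L))))
    (h5 : ∃ u v w : 𝓞 L, g * algebraMap (𝓞 K) (𝓞 L) β = y * (u * (n : 𝓞 L) + v * algebraMap (𝓞 K) (𝓞 L) β + w * (s + (t : 𝓞 L))))
    (h6 : ∃ u v w : 𝓞 L, g * (s - (t : 𝓞 L)) = y * (u * (n : 𝓞 L) + v * algebraMap (𝓞 K) (𝓞 L) β + w * (s + (t : 𝓞 L))))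
    (hI : Ideal.span ({(n : 𝓞 L), algebraMap (𝓞 K) (𝓞 L) β, s - (t : 𝓞 L)} : Set (𝓞 L)) ∈ (Ideal (𝓞 L))⁰) (τ : L ≃ₐ[K] L) :
    ClassGroup.mulEquiv (intAut τ) (ClassGroup.mk0 ⟨_, hI⟩) = ClassGroup.mk0 ⟨_, hI⟩ := by
  have hid : Ideal.span {y} * Ideal.span ({(n : 𝓞 L), algebraMap (𝓞 K) (𝓞 L) β, s + (t : 𝓞 L)} : Set (𝓞 L)) =
      Ideal.span {g} * Ideal.span ({(n : 𝓞 L), algebraMap (𝓞 K) (𝓞 L) β, s - (t : 𝓞 L)} : Set (𝓞 L)) :=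
    span_singleton_mul_span_triple_eq h1 h2 h3 h4 h5 h6
  rw [mulEquiv_mk0]
  rcases map_intAut_span_triple_eq_or τ hs n β t with h | h
  · congr 1; exact Subtype.ext h
  · have hI1 : Ideal.span ({(n : 𝓞 L), algebraMap (𝓞 K) (𝓞 L) β, s + (t : 𝓞 L)} : Set (𝓞 L)) ∈ (Ideal (𝓞 L))⁰ := by
      rw [← h]; exact map_mem_nonZeroDivisors τ ⟨_, hI⟩
    have hy : y ≠ 0 := by
      rintro rfl
      rw [Ideal.span_singleton_eq_bot.mpr rfl, Ideal.bot_mul, eq_comm, Ideal.mul_eq_bot, Ideal.span_singleton_eq_bot] at hid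
      rcases hid with hg0 | hI0
      · exact hg hg0
      · exact nonZeroDivisors.ne_zero hI hI0
    have : (⟨_, map_mem_nonZeroDivisors τ ⟨_, hI⟩⟩ : (Ideal (𝓞 L))⁰) = ⟨_, hI1⟩ := Subtype.ext h
    rw [this]
    exact ClassGroup.mk0_eq_mk0_iff.mpr ⟨y, g, hy, hg, hid⟩

end Galois


/-- **A second generator of `𝓞 L` over `𝓞 K`**: if `s² = 2` and `π² c = 2` with `π ≠ 0` (`π, c ∈ 𝓞 L`), then `s = π e` for some
`e ∈ 𝓞 L` with `e² = c` (`e = s/π` is integral, being a square root of the algebraic integer `c`). Used when `𝓞 K(√2) ≠ 𝓞 K[√2]`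
(e.g. `2` totally ramified in `K`, `π` a uniformiser). [cite: Marcus1977, Ch. 2 Thm. 2 and Cor. 2] -/
theorem exists_eq_mul_and_sq_eq {L : Type} [Field L] (s π c : 𝓞 L) (hs : s ^ 2 = 2) (hπc : π ^ 2 * c = 2) (hπ : π ≠ 0) :
    ∃ e : 𝓞 L, s = π * e ∧ e ^ 2 = c := by
  have hπL : (π : L) ≠ 0 := fun h => hπ (RingOfIntegers.ext (by simpa using h))
  set e₀ : L := (s : L) / (π : L) with he₀
  have hsL : (s : L) ^ 2 = 2 := by
    have := congrArg (algebraMap (𝓞 L) L) hs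
    rwa [map_pow, map_ofNat] at this
  have hπcL : (π : L) ^ 2 * (c : L) = 2 := by
    have := congrArg (algebraMap (𝓞 L) L) hπc
    rwa [map_mul, map_pow, map_ofNat] at this
  have he2 : e₀ ^ 2 = (c : L) := by
    rw [he₀, div_pow, hsL, ← hπcL]
    field_simp
  have hint : IsIntegral ℤ e₀ := by
    refine IsIntegral.of_pow two_pos ?_
    rw [he2]
    exact c.2
  refine ⟨⟨e₀, hint⟩, ?_, ?_⟩
  · apply RingOfIntegers.ext
    change (s : L) = algebraMap (𝓞 L) L (π * ⟨e₀, hint⟩)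
    rw [map_mul]
    change (s : L) = (π : L) * e₀
    rw [he₀, mul_div_cancel₀ _ hπL]
  · apply RingOfIntegers.ext
    change algebraMap (𝓞 L) L (⟨e₀, hint⟩ ^ 2) = (c : L)
    rw [map_pow]
    exact he2

/-- **`[I · (ω)] = [I]`**: a principal factor does not change the ideal class. [folklore] -/
theorem mk0_eq_mk0_of_eq_mul_span_singleton {A : Type} [CommRing A] [IsDedekindDomain A] {I J : Ideal A} {ω : A} (hω : ω ≠ 0)
    (hIJ : J = I * Ideal.span {ω}) (hI : I ∈ (Ideal A)⁰) (hJ : J ∈ (Ideal A)⁰) :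
    ClassGroup.mk0 ⟨J, hJ⟩ = ClassGroup.mk0 ⟨I, hI⟩ :=
  ClassGroup.mk0_eq_mk0_iff.mpr ⟨1, ω, one_ne_zero, hω, by
    change Ideal.span {1} * J = Ideal.span {ω} * I
    rw [Ideal.span_singleton_one, Ideal.top_mul, hIJ, mul_comm]⟩

/-- **An algebraic integer with denominator `2`**: if `T ∈ 𝓞 L` satisfies `T² + 2t₁T + 4t₀ = 0` with `t₁, t₀ ∈ 𝓞 L`, then `T = 2ω` for
some `ω ∈ 𝓞 L` (`ω = T/2` is a root of the monic `X² + t₁X + t₀ ∈ 𝓞 L[X]`, hence integral). This presents elements of `𝓞 K(√2)`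
outside `𝓞 K[√2]` (index `2` or `4` at the primes above `2`). [cite: Marcus1977, Ch. 2 Thm. 2 and Cor. 2] -/
theorem exists_two_mul_eq_of_quadratic {L : Type} [Field L] [NumberField L] (T t₁ t₀ : 𝓞 L)
    (h : T ^ 2 + 2 * t₁ * T + 4 * t₀ = 0) : ∃ ω : 𝓞 L, 2 * ω = T := by
  have hL : (T : L) ^ 2 + 2 * (t₁ : L) * (T : L) + 4 * (t₀ : L) = 0 := by
    have := congrArg ((↑) : 𝓞 L → L) h
    push_cast at this
    exact this
  have hroot : ((T : L) / 2) ^ 2 + (t₁ : L) * ((T : L) / 2) + (t₀ : L) = 0 := by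
    linear_combination hL / 4
  have hint' : IsIntegral (𝓞 L) ((T : L) / 2) := by
    refine ⟨X ^ 2 + C t₁ * X + C t₀, ?_, ?_⟩
    · have : (X ^ 2 + C t₁ * X + C t₀ : (𝓞 L)[X]) = X ^ 2 + (C t₁ * X + C t₀) := by ring
      rw [this]
      refine (monic_X_pow 2).add_of_left ?_
      refine lt_of_le_of_lt (degree_add_le _ _) (max_lt ?_ ?_)
      · exact lt_of_le_of_lt (degree_C_mul_X_le _) (by rw [degree_X_pow]; norm_num)
      · exact lt_of_le_of_lt degree_C_le (by rw [degree_X_pow]; norm_num)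
    · simp only [eval₂_add, eval₂_mul, eval₂_pow, eval₂_X, eval₂_C]
      exact hroot
  obtain ⟨ω, hω⟩ := (IsIntegrallyClosed.isIntegral_iff (R := 𝓞 L) (K := L)).mp hint'
  refine ⟨ω, ?_⟩
  apply RingOfIntegers.ext
  change algebraMap (𝓞 L) L (2 * ω) = (T : L)
  rw [map_mul, hω, map_ofNat]
  ring

/-! ## §2 The certificate and the door at the first layer of the cyclotomic `ℤ₂`-tower -/

section LayerOne

variable {K : Type} [Field K] [NumberField K]

/-- **THE AMBIGUOUS CLASS FROM A CAPITULATION CERTIFICATE.** `K` of odd degree, `κ` its cyclotomic `ℤ₂`-extension, `K₁ = K(√2)` the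
first layer. DATA: `n ∈ ℕ`, `β ∈ 𝓞 K` with `⟨[(n, β)]⟩ = Cl(K)` (e.g. `(n, β) = (ℓ₀, θ − r₀)` a degree-one prime certified by
`…ClassGroupCyclicCriterion`); integers `t, w, u, v, a, c` with `t² − 2 = n w`, `u n + v w = 1`, `a · 2t + c n = 1`; and, for every
extension `L/K` and `s ∈ 𝓞 L` with `s² = 2` (it is applied to `L = K₁`), elements `y, g ∈ 𝓞 L`, `g ≠ 0`, with
`(y)(n, β, s + t) = (g)(n, β, s − t)` (given as six generator memberships with explicit coefficients — pure ring identities). THEN the class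
`c = [(n, β, s − t)]` of `Cl(K₁)` is `Gal(K₁/K)`-fixed (§4) and `h_K ∣ ord N_{K₁/K} c` (§3: `N c = [(n, β)]`) — the certificate consumed by
the capitulation doors. [cite: Lang1990, Ch. 13 §4, Lemma 4.1] [cite: Gras2003, II.6.2.3] -/
theorem exists_ambiguous_of_certificate (hK2 : ¬ 2 ∣ Module.finrank ℚ K) (κ : ZpExtension K 2) (hκ : κ.IsCyclotomic)
    {n : ℕ} (hn : n ≠ 0) {β : 𝓞 K} (h0 : Ideal.span ({(n : 𝓞 K), β} : Set (𝓞 K)) ∈ (Ideal (𝓞 K))⁰)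
    (hgen : Subgroup.zpowers (ClassGroup.mk0 ⟨_, h0⟩) = ⊤)
    {t w u v a c : ℤ} (htw : t ^ 2 - 2 = n * w) (huv : u * n + v * w = 1) (hac : a * (2 * t) + c * n = 1)
    (hcert : ∀ (L : Type) [Field L] [NumberField L] [Algebra K L] (s : 𝓞 L), s ^ 2 = 2 → ∃ y g : 𝓞 L, g ≠ 0 ∧
        (∃ u v w : 𝓞 L, y * (n : 𝓞 L) = g * (u * (n : 𝓞 L) + v * algebraMap (𝓞 K) (𝓞 L) β + w * (s - (t : 𝓞 L)))) ∧
        (∃ u v w : 𝓞 L, y * algebraMap (𝓞 K) (𝓞 L) β = g * (u * (n : 𝓞 L) + v * algebraMap (𝓞 K) (𝓞 L) β + w * (s - (t : 𝓞 L)))) ∧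
        (∃ u v w : 𝓞 L, y * (s + (t : 𝓞 L)) = g * (u * (n : 𝓞 L) + v * algebraMap (𝓞 K) (𝓞 L) β + w * (s - (t : 𝓞 L)))) ∧
        (∃ u v w : 𝓞 L, g * (n : 𝓞 L) = y * (u * (n : 𝓞 L) + v * algebraMap (𝓞 K) (𝓞 L) β + w * (s + (t : 𝓞 L)))) ∧
        (∃ u v w : 𝓞 L, g * algebraMap (𝓞 K) (𝓞 L) β = y * (u * (n : 𝓞 L) + v * algebraMap (𝓞 K) (𝓞 L) β + w * (s + (t : 𝓞 L)))) ∧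
        (∃ u v w : 𝓞 L, g * (s - (t : 𝓞 L)) = y * (u * (n : 𝓞 L) + v * algebraMap (𝓞 K) (𝓞 L) β + w * (s + (t : 𝓞 L))))) :
    haveI : FiniteDimensional K (κ.layer 1) := κ.finiteDimensional_layer_holds 1
    haveI : NumberField (κ.layer 1) := NumberField.of_module_finite K (κ.layer 1)
    ∃ (cl : ClassGroup (𝓞 (κ.layer 1))) (m : ℕ), Odd m ∧
      (∀ τ : κ.layer 1 ≃ₐ[K] κ.layer 1, ClassGroup.mulEquiv (intAut τ) cl = cl) ∧
      classNumber K ∣ m * orderOf (classGroupNorm K (κ.layer 1) cl) := by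
  classical
  haveI : FiniteDimensional K (κ.layer 1) := κ.finiteDimensional_layer_holds 1
  haveI : IsGalois K (κ.layer 1) := κ.isGalois_layer_holds 1
  haveI : NumberField (κ.layer 1) := NumberField.of_module_finite K (κ.layer 1)
  set L := κ.layer 1 with hLdef
  have hdeg : Module.finrank K L = 2 := by rw [hLdef, κ.finrank_layer_holds 1, pow_one]
  obtain ⟨s₀, hs₀⟩ := exists_sq_eq_two_layer_one_of_not_dvd_finrank hK2 κ hκ
  -- `s₀ ∈ 𝓞 L`
  have hsint : IsIntegral ℤ s₀ := by
    refine IsIntegral.of_pow two_pos ?_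
    rw [hs₀, show (2 : L) = algebraMap ℤ L 2 by norm_num]
    exact isIntegral_algebraMap
  set s : 𝓞 L := ⟨s₀, hsint⟩ with hsdef
  have hs : s ^ 2 = 2 := by
    apply RingOfIntegers.ext
    change algebraMap (𝓞 L) L (s ^ 2) = algebraMap (𝓞 L) L 2
    rw [map_pow, map_ofNat]
    exact hs₀
  obtain ⟨y, g, hg, h1, h2, h3, h4, h5, h6⟩ := hcert L s hs
  set I : Ideal (𝓞 L) := Ideal.span ({(n : 𝓞 L), algebraMap (𝓞 K) (𝓞 L) β, s - (t : 𝓞 L)} : Set (𝓞 L)) with hIdef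
  have hI0 : I ∈ (Ideal (𝓞 L))⁰ := by
    refine mem_nonZeroDivisors_of_ne_zero fun h => ?_
    have hmem : (n : 𝓞 L) ∈ I := Ideal.subset_span (by simp)
    rw [h] at hmem
    exact hn (Nat.cast_eq_zero.mp ((Submodule.mem_bot (𝓞 L)).mp hmem))
  -- `σ s = -s` and `I · σI = (n, β) 𝓞 L`
  obtain ⟨σ, hσ⟩ := exists_intAut_eq_neg hdeg (sq_ne_two_of_odd_finrank hK2) hs
  have hprod : I * I.map (intAut σ : 𝓞 L →+* 𝓞 L) = (Ideal.span ({(n : 𝓞 K), β} : Set (𝓞 K))).map (algebraMap (𝓞 K) (𝓞 L)) := by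
    rw [hIdef, map_intAut_span_triple, map_natCast, intAut_algebraMap, map_sub, map_intCast, hσ,
      show -s - (t : 𝓞 L) = -(s + (t : 𝓞 L)) by ring, span_triple_neg_last,
      span_triple_mul_span_triple_eq_span_pair n _ s t w u v a c hs htw huv hac, Ideal.map_span, Set.image_insert_eq,
      Set.image_singleton, map_natCast]
  -- the ambiguous class and its norm
  have hfix : ∀ τ : L ≃ₐ[K] L, ClassGroup.mulEquiv (intAut τ) (ClassGroup.mk0 ⟨I, hI0⟩) = ClassGroup.mk0 ⟨I, hI0⟩ := fun τ =>
    mulEquiv_intAut_mk0_eq_self_of_identity hs n β t hg h1 h2 h3 h4 h5 h6 hI0 τ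
  have hN : classGroupNorm K L (ClassGroup.mk0 ⟨I, hI0⟩) = ClassGroup.mk0 ⟨_, h0⟩ :=
    classGroupNorm_mk0_eq_of_mul_map_eq hdeg σ hprod hI0 h0
  have hord : classNumber K ∣ 1 * orderOf (classGroupNorm K L (ClassGroup.mk0 ⟨I, hI0⟩)) := by
    rw [one_mul, hN, ← classNumber_eq_orderOf_of_zpowers_eq_top K hgen]
  exact ⟨ClassGroup.mk0 ⟨I, hI0⟩, 1, odd_one, hfix, hord⟩

/-- **`e₁ = e₀` FROM A CAPITULATION CERTIFICATE, one prime above `2`.** `K` of odd degree with at most one prime above `2`, `κ` its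
cyclotomic `ℤ₂`-extension, plus the data of `exists_ambiguous_of_certificate`. THEN `classNumberPExp κ 1 = classNumberPExp κ 0` — the
displayed hypothesis of the census stamps `conjA_two_<L>_of_fukudaLayers` — by `…CapitulationDoorLayerOne`.
[cite: Lang1990, Ch. 13 §4, Lemma 4.1] [cite: Gras2003, II.6.2.3] -/
theorem classNumberPExp_one_eq_classNumberPExp_zero_of_certificate (hK2 : ¬ 2 ∣ Module.finrank ℚ K) (κ : ZpExtension K 2)
    (hκ : κ.IsCyclotomic) (hs1 : {v : HeightOneSpectrum (𝓞 K) | ((2 : ℕ) : 𝓞 K) ∈ v.asIdeal}.ncard ≤ 1)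
    {n : ℕ} (hn : n ≠ 0) {β : 𝓞 K} (h0 : Ideal.span ({(n : 𝓞 K), β} : Set (𝓞 K)) ∈ (Ideal (𝓞 K))⁰)
    (hgen : Subgroup.zpowers (ClassGroup.mk0 ⟨_, h0⟩) = ⊤)
    {t w u v a c : ℤ} (htw : t ^ 2 - 2 = n * w) (huv : u * n + v * w = 1) (hac : a * (2 * t) + c * n = 1)
    (hcert : ∀ (L : Type) [Field L] [NumberField L] [Algebra K L] (s : 𝓞 L), s ^ 2 = 2 → ∃ y g : 𝓞 L, g ≠ 0 ∧
        (∃ u v w : 𝓞 L, y * (n : 𝓞 L) = g * (u * (n : 𝓞 L) + v * algebraMap (𝓞 K) (𝓞 L) β + w * (s - (t : 𝓞 L)))) ∧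
        (∃ u v w : 𝓞 L, y * algebraMap (𝓞 K) (𝓞 L) β = g * (u * (n : 𝓞 L) + v * algebraMap (𝓞 K) (𝓞 L) β + w * (s - (t : 𝓞 L)))) ∧
        (∃ u v w : 𝓞 L, y * (s + (t : 𝓞 L)) = g * (u * (n : 𝓞 L) + v * algebraMap (𝓞 K) (𝓞 L) β + w * (s - (t : 𝓞 L)))) ∧
        (∃ u v w : 𝓞 L, g * (n : 𝓞 L) = y * (u * (n : 𝓞 L) + v * algebraMap (𝓞 K) (𝓞 L) β + w * (s + (t : 𝓞 L)))) ∧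
        (∃ u v w : 𝓞 L, g * algebraMap (𝓞 K) (𝓞 L) β = y * (u * (n : 𝓞 L) + v * algebraMap (𝓞 K) (𝓞 L) β + w * (s + (t : 𝓞 L)))) ∧
        (∃ u v w : 𝓞 L, g * (s - (t : 𝓞 L)) = y * (u * (n : 𝓞 L) + v * algebraMap (𝓞 K) (𝓞 L) β + w * (s + (t : 𝓞 L))))) :
    classNumberPExp κ 1 = classNumberPExp κ 0 :=
  classNumberPExp_one_eq_classNumberPExp_zero_of_ambiguous hK2 κ hκ hs1
    (exists_ambiguous_of_certificate hK2 κ hκ hn h0 hgen htw huv hac hcert)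

omit [NumberField K] in
/-- From «exactly one prime above `2`» (the `∃!` form of the unique-prime doors) to the `ncard ≤ 1` form. [folklore] -/
theorem ncard_primes_above_two_le_one_of_existsUnique
    (h : ∃! v : HeightOneSpectrum (𝓞 K), ((2 : ℕ) : 𝓞 K) ∈ v.asIdeal) :
    {v : HeightOneSpectrum (𝓞 K) | ((2 : ℕ) : 𝓞 K) ∈ v.asIdeal}.ncard ≤ 1 := by
  have hsub : {v : HeightOneSpectrum (𝓞 K) | ((2 : ℕ) : 𝓞 K) ∈ v.asIdeal}.Subsingleton := by
    intro v hv w hw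
    obtain ⟨u, -, hu⟩ := h
    rw [hu v hv, hu w hw]
  rcases hsub.eq_empty_or_singleton with h0 | ⟨v, hv⟩
  · rw [h0, Set.ncard_empty]; exact zero_le_one
  · rw [hv, Set.ncard_singleton]

end LayerOne

end Summit.BirchSwinnertonDyer.BirchSwinnertonDyer.Theorems.AddKatoTwo

end
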